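import Summits.ResolutionOfSingularities.ResolutionOfSingularities.Theorems.FrobeniusLadderFInjectiveMacaulayficationFCUnguardedLocDimLe3
import Summits.ResolutionOfSingularities.ResolutionOfSingularities.Theorems.FrobeniusLadderFInjectiveMacaulayficationLocFixAtNonClosedDimOne
import HarnessLib

/-!
# (T1‴) `LocFixAtNonClosedDimOne` HOLDS, unconditionally — the by-name closer of door v31's would-be stub `stub_locFixAtNonClosedDimOne`,
# and FC″ in local dimension ≤ 3 from the residual `RelClosedSubsetFixPow` ALONE modulo the named facts
# (crux `FInjectiveMacaulayfication` stmt-ResolutionOfSingularities-15315, chain w45a; res-L1-w45a-plan-1 R16.19 (2)/(4), R16.21 (3); seat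
# res-L1-w45a-stub-1 g6)

[OURS · L1 W4.5a] Support file (`--supports stmt-ResolutionOfSingularities-15315 --as helper`); NOT a statement of any manuscript;
AI-written (AI review is weaker than expert review). Two one-liners: res-L1-w45a-stub-3's typed target
`FCUnguardedLocDimLe3.LocFixAtNonClosedDimOne` IS the tree theorem `LocFixAtNonClosedDimOne.locFixAprime_atNonClosed_dimOne` (conductor
blow-up of the one-dimensional local domain, `PointFixDimOneVariety.h4Loc_of_dim_one_variety`; NO named fact), and therefore stub-3's
`fcUnguardedLocDimLe3_of_facts` loses its `(T1‴)` hypothesis: **FC″ at every non-closed bad point of local dimension ≤ 3 follows from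
the single research residual `FCUnguardedAprime.RelClosedSubsetFixPow`** modulo Lipman 1978, Cossart–Piltant 2019 (General,
Principalization), Stacks 081R, Datta–Murayama 2024 Thm. B and `CMLocusOpen` (itself a theorem of EGA IV₂ 6.11.3 in the tree).
[folklore assembly]
-/

-- single-problem summit: the doubled namespace component is forced
set_option linter.dupNamespace false

noncomputable section

namespace Summit.ResolutionOfSingularities.ResolutionOfSingularities.Theorems.FInjectiveMacaulayfication.FCUnguardedLocDimLe3

open Summit.ResolutionOfSingularities.ResolutionOfSingularities.Theorems.FInjectiveMacaulayfication

/-- **(T1‴) HOLDS, unconditionally**: the (A′) LocFix datum at every non-closed bad point of local dimension one — by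
`LocFixAtNonClosedDimOne.locFixAprime_atNonClosed_dimOne` (conductor blow-up; no named fact). [folklore assembly] -/
theorem locFixAtNonClosedDimOne_holds : LocFixAtNonClosedDimOne :=
  fun p hp k _ _ X₁ f₁ hs hft hqc hi h4 hCM η hη hbad hdim hgen =>
    LocFixAtNonClosedDimOne.locFixAprime_atNonClosed_dimOne p hp k X₁ f₁ hs hft hqc hi h4 hCM η hη hbad hdim hgen

/-- **FC″ IN LOCAL DIMENSION ≤ 3 ⟸ `RelClosedSubsetFixPow` ALONE, modulo the named facts** (stub-3's `fcUnguardedLocDimLe3_of_facts`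
with (T1‴) discharged by `locFixAtNonClosedDimOne_holds`). This is the term door v31 derives `stub_fcUnguarded` from, minus one stub.
[folklore assembly; cite: Lipman1978; CossartPiltant2019, Thm. 1.1; DattaMurayama2024, Thm. B] -/
theorem fcUnguardedLocDimLe3_of_relClosedSubsetFixPow
    (hL : Literature.AlgebraicGeometry.Resolution.Lipman1978SequenceFinite.{0})
    (hG : Literature.AlgebraicGeometry.Resolution.CossartPiltant2019General.{0})
    (h081R : Literature.AlgebraicGeometry.Resolution.Stacks081R.{0})
    (hP : Literature.AlgebraicGeometry.Resolution.CossartPiltant2019Principalization.{0})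
    (hDM : Literature.AlgebraicGeometry.Resolution.DattaMurayama2024_fInjectiveLocusOpen.{0})
    (hCMo : NonFullLocusClosed.CMLocusOpen) (h₃ : FCUnguardedAprime.RelClosedSubsetFixPow) : FCUnguardedLocDimLe3 :=
  fcUnguardedLocDimLe3_of_facts hL hG h081R hP hDM hCMo locFixAtNonClosedDimOne_holds h₃

/-- **The residual `FCUnguardedDimGe4` ⟸ `RelClosedSubsetFixPow` + the declared d ≥ 5 residual `FCUnguardedLocDimGe4`**, modulo the
named facts. [folklore assembly] -/
theorem fcUnguardedDimGe4_of_relClosedSubsetFixPow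
    (hL : Literature.AlgebraicGeometry.Resolution.Lipman1978SequenceFinite.{0})
    (hG : Literature.AlgebraicGeometry.Resolution.CossartPiltant2019General.{0})
    (h081R : Literature.AlgebraicGeometry.Resolution.Stacks081R.{0})
    (hP : Literature.AlgebraicGeometry.Resolution.CossartPiltant2019Principalization.{0})
    (hDM : Literature.AlgebraicGeometry.Resolution.DattaMurayama2024_fInjectiveLocusOpen.{0})
    (hCMo : NonFullLocusClosed.CMLocusOpen) (h₃ : FCUnguardedAprime.RelClosedSubsetFixPow)
    (h₄ : FCUnguardedAprime.FCUnguardedLocDimGe4) : FCUnguardedRungs.FCUnguardedDimGe4 :=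
  fcUnguardedDimGe4_of_le3_ge4 (fcUnguardedLocDimLe3_of_relClosedSubsetFixPow hL hG h081R hP hDM hCMo h₃) h₄

end Summit.ResolutionOfSingularities.ResolutionOfSingularities.Theorems.FInjectiveMacaulayfication.FCUnguardedLocDimLe3

end
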